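import Summits.CriticalPhenomena.PercolationContinuityZ3.Theorems.PercNearOneGluingNoHeavyQuantShapePieceBlob
import HarnessLib

/-!
# QUANT lane R8, T-DEC: THE PIECE BESIDE A BIG BLOB FOR EVERY SHAPE `lo < K ≤ 4lo` AND EVERY GATE — certified brick PC2cXD, shape box B (census-1 gen 33)

builds on p205010 (kernel theorem, internal audit signed; external expert review pending)

Support file (`--supports stmt-CriticalPhenomena-4575`), QUANT lane seat prim-quant-census-1 (gen 33); memo
`run/shared/lean/prim/quant/prim-quant-census-1/g33/WIDE3-G33.md` §4.  Theorems only, standard axioms, no sorries.  This file: `pbB_PC2cXD`.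
THE RULE (memo §4; exact regression `g33/code/exp6_pieceblob_rule.py`, 0 failures on 13 shapes `lo < K ≤ 4lo`): per outer gate, the low atom `lo` of
`S(γ) ∗ blob_{lo+K}(g)` goes to `2lo+K` while `θ₁(ν(lo)+ν(2lo+K)) ≤ ν(2lo+K)` (`θ₁ = max(y, D/(lo+K))`, `D = T − 2lo`); otherwise the flow
SPLITS — `a(1−γ)g(lo+K−D)/D` saturates `2lo+K`, the overflow `a(1−γ)(D−(lo+K)g)/D` goes to the top; for `D ≥ lo+K` everything goes to the top.
Bricks (polynomial inequalities in `lo, K, γ, g, D` (and `y`/`x`), K-units `c = lo/K ∈ [1/4, 1]` split into the boxes `[1/4,1/3]`, `[1/3,1/2]`, `[1/2,1]`):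
PB1/PB2 (top capacity of the overflow: ρ / floor), PC1a–c / PC2a–c (split cost: ρ / floor regime, three budget sub-cases), PD1/PD2 (top capacity,
regime II), PE1/PE2 (top cost, regime II); the floor-regime bricks are certified at the floor bound `ȳ = (2lo+D)·x_max/T₀` (`…GD` / `…XD` for
`x_max = g` / `(lo+Kγ)/(lo+K)`) and transported to every `y ≤ ȳ` by monotonicity (`pb_glue_cap`, `pb_glue_cost`).  Certificates: Handelman products found
by kit (`g33/code/kitjob6`: scipy/HiGHS dual simplex for the support + exact rational repair), checked here by `linarith`.

HONEST STATUS.  Algebra only.  `SiblingStep`, `GluedDominatedMass`, `SDECConvClosed`, `FarTreeRow` OPEN; RATE class (log\*) / honest sentence of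
`run/shared/lean/prim/quant/README.md` unchanged.  [this work].  Nothing here is cited as a published result.  The gluing rows served
[cite: KozmaNitzan2024, Conjecture 3 (p. 15)]; product measure [cite: Grimmett1999, §1.3 p. 10].
-/

noncomputable section

open scoped BigOperators

namespace Summit.CriticalPhenomena.PercolationContinuityZ3.Theorems
namespace Quant
namespace LawDec

set_option maxRecDepth 8192 in
set_option maxHeartbeats 4000000 in
/-- **split cost, floor regime at `ȳ`, `T ≥ 2lo+K`, case X**, `lo/K ∈ [1/3, 1/2]` — degree-5 Handelman certificate, 219 products (kit j301117). [this work] -/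
theorem pbB_PC2cXD (lo K γ g D : ℝ) (hlo : 0 < lo)
    (hK1 : 2 * lo ≤ K) (hK2 : K ≤ 3 * lo) (hγ : lo ≤ K * γ) (hγ1 : γ ≤ 1) (hbig : 2 * lo ≤ (lo + K) * g) (hg1 : g ≤ 1)
    (hD : 0 ≤ D) (hDBg' : (lo + K) * g ≤ D) (hBD' : D ≤ lo + K) (hDmax' : D ≤ (K * γ - lo + (lo + K) * g)) (hTh1' : K ≤ D)
    (hγ0 : 0 ≤ γ) (hg0 : 0 ≤ g) (hxmX : lo + K * γ ≤ (lo + K) * g)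
    (hTPX : (2 * lo + D) * (lo + K * γ) ≤ (lo + K) * (lo + K * γ + (lo + K) * g))
    (hyLX : D * (lo + K * γ + (lo + K) * g) * (lo + K) ≤ (2 * lo + D) * (lo + K * γ) * (lo + 2 * K)) :
    (2 * K - D) * ((2 * lo + D) * (lo + K * γ)) * (1 - γ) * (D - (lo + K) * g)
      ≤ (((1 - γ) * (1 - g)) * (lo + D) + (γ * (1 - g)) * (lo + D - K) + ((1 - γ) * g) * (D - K)) * D * ((lo + K) * (lo + K * γ + (lo + K) * g) - (2 * lo + D) * (lo + K * γ)) := by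
  have hK : 0 < K := lt_of_lt_of_le (by linarith) hK1
  have hA : 0 ≤ K * γ - lo := sub_nonneg.2 hγ
  have hE : 0 ≤ 1 - γ := sub_nonneg.2 hγ1
  have hBig : 0 ≤ (lo + K) * g - 2 * lo := sub_nonneg.2 hbig
  have hEg : 0 ≤ 1 - g := sub_nonneg.2 hg1
  have hClo : 0 ≤ 3 * lo - K := by linarith [hK2]
  have hChi : 0 ≤ K - 2 * lo := by linarith [hK1]
  have hD0 : 0 ≤ D := hD
  have hDBg : 0 ≤ D - (lo + K) * g := sub_nonneg.2 hDBg'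
  have hBD : 0 ≤ lo + K - D := sub_nonneg.2 hBD'
  have hDmax : 0 ≤ (K * γ - lo + (lo + K) * g) - D := sub_nonneg.2 hDmax'
  have hTh1 : 0 ≤ D - K := sub_nonneg.2 hTh1'
  have hXMX : 0 ≤ (lo + K) * g - (lo + K * γ) := sub_nonneg.2 hxmX
  have hTPXf : 0 ≤ (lo + K) * (lo + K * γ + (lo + K) * g) - (2 * lo + D) * (lo + K * γ) := sub_nonneg.2 hTPX
  have hYLX : 0 ≤ (2 * lo + D) * (lo + K * γ) * (lo + 2 * K) - D * (lo + K * γ + (lo + K) * g) * (lo + K) := sub_nonneg.2 hyLX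
  have hH : 0 ≤ g := hg0
  have hGam : 0 ≤ γ := hγ0
  have key : 0 ≤ K ^ 2 * ((((1 - γ) * (1 - g)) * (lo + D) + (γ * (1 - g)) * (lo + D - K) + ((1 - γ) * g) * (D - K)) * D * ((lo + K) * (lo + K * γ + (lo + K) * g) - (2 * lo + D) * (lo + K * γ))
      - ((2 * K - D) * ((2 * lo + D) * (lo + K * γ)) * (1 - γ) * (D - (lo + K) * g))) := by
    linarith [mul_nonneg (mul_nonneg (mul_nonneg hXMX hYLX) hK.le) hK.le,
      mul_nonneg (mul_nonneg (mul_nonneg (mul_nonneg (mul_nonneg hDmax hXMX) hXMX) hXMX) hK.le) hK.le,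
      mul_nonneg (mul_nonneg (mul_nonneg (mul_nonneg (mul_nonneg hDmax hH) hH) hXMX) hYLX) hK.le,
      mul_nonneg (mul_nonneg (mul_nonneg hDmax hDmax) hXMX) hYLX,
      mul_nonneg (mul_nonneg hBD hYLX) hTPXf,
      mul_nonneg (mul_nonneg (mul_nonneg (mul_nonneg (mul_nonneg hBD hXMX) hK.le) hK.le) hK.le) hK.le,
      mul_nonneg (mul_nonneg (mul_nonneg hBD hXMX) hYLX) hK.le,
      mul_nonneg (mul_nonneg (mul_nonneg (mul_nonneg hBD hTh1) hXMX) hXMX) hTPXf,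
      mul_nonneg (mul_nonneg (mul_nonneg (mul_nonneg (mul_nonneg hBD hTh1) hTh1) hTh1) hTh1) hK.le,
      mul_nonneg (mul_nonneg (mul_nonneg (mul_nonneg hBD hDmax) hTh1) hTPXf) hK.le,
      mul_nonneg (mul_nonneg (mul_nonneg (mul_nonneg hBD hDmax) hDmax) hXMX) hTPXf,
      mul_nonneg (mul_nonneg (mul_nonneg (mul_nonneg (mul_nonneg hBD hBD) hXMX) hXMX) hXMX) hK.le,
      mul_nonneg (mul_nonneg (mul_nonneg (mul_nonneg (mul_nonneg hBD hBD) hBD) hDmax) hXMX) hK.le,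
      mul_nonneg (mul_nonneg (mul_nonneg (mul_nonneg (mul_nonneg hBD hBD) hBD) hBD) hBD) hK.le,
      mul_nonneg (mul_nonneg (mul_nonneg (mul_nonneg hDBg hXMX) hTPXf) hK.le) hK.le,
      mul_nonneg (mul_nonneg (mul_nonneg (mul_nonneg (mul_nonneg hDBg hXMX) hXMX) hXMX) hXMX) hK.le,
      mul_nonneg (mul_nonneg (mul_nonneg hDBg hTh1) hYLX) hK.le,
      mul_nonneg (mul_nonneg (mul_nonneg (mul_nonneg (mul_nonneg hDBg hBD) hDmax) hDmax) hDmax) hK.le,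
      mul_nonneg (mul_nonneg (mul_nonneg (mul_nonneg hDBg hBD) hBD) hXMX) hTPXf,
      mul_nonneg (mul_nonneg (mul_nonneg (mul_nonneg hDBg hDBg) hTh1) hXMX) hTPXf,
      mul_nonneg (mul_nonneg (mul_nonneg (mul_nonneg (mul_nonneg hDBg hDBg) hH) hH) hYLX) hK.le,
      mul_nonneg (mul_nonneg (mul_nonneg (mul_nonneg (mul_nonneg hDBg hDBg) hDmax) hTh1) hXMX) hK.le,
      mul_nonneg (mul_nonneg (mul_nonneg (mul_nonneg hDBg hDBg) hBD) hDmax) hTPXf,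
      mul_nonneg (mul_nonneg (mul_nonneg (mul_nonneg (mul_nonneg hDBg hDBg) hBD) hBD) hDmax) hK.le,
      mul_nonneg (mul_nonneg (mul_nonneg (mul_nonneg (mul_nonneg hDBg hDBg) hDBg) hH) hTPXf) hK.le,
      mul_nonneg (mul_nonneg (mul_nonneg (mul_nonneg (mul_nonneg hDBg hDBg) hDBg) hDBg) hXMX) hK.le,
      mul_nonneg (mul_nonneg (mul_nonneg (mul_nonneg (mul_nonneg hD0 hH) hGam) hXMX) hYLX) hK.le,
      mul_nonneg (mul_nonneg (mul_nonneg (mul_nonneg (mul_nonneg hD0 hDmax) hTh1) hTh1) hXMX) hK.le,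
      mul_nonneg (mul_nonneg (mul_nonneg (mul_nonneg hD0 hBD) hTPXf) hK.le) hK.le,
      mul_nonneg (mul_nonneg (mul_nonneg hD0 hBD) hTPXf) hTPXf,
      mul_nonneg (mul_nonneg (mul_nonneg (mul_nonneg (mul_nonneg hD0 hBD) hDmax) hDmax) hXMX) hK.le,
      mul_nonneg (mul_nonneg (mul_nonneg (mul_nonneg (mul_nonneg hD0 hDBg) hH) hXMX) hTPXf) hK.le,
      mul_nonneg (mul_nonneg (mul_nonneg (mul_nonneg (mul_nonneg hD0 hDBg) hBD) hDmax) hK.le) hK.le,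
      mul_nonneg (mul_nonneg (mul_nonneg (mul_nonneg (mul_nonneg hD0 hDBg) hDBg) hTh1) hTh1) hK.le,
      mul_nonneg (mul_nonneg (mul_nonneg (mul_nonneg (mul_nonneg (mul_nonneg hD0 hDBg) hDBg) hGam) hXMX) hK.le) hK.le,
      mul_nonneg (mul_nonneg (mul_nonneg (mul_nonneg (mul_nonneg (mul_nonneg hD0 hDBg) hDBg) hH) hXMX) hK.le) hK.le,
      mul_nonneg (mul_nonneg (mul_nonneg (mul_nonneg (mul_nonneg hD0 hDBg) hDBg) hDBg) hDBg) hK.le,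
      mul_nonneg (mul_nonneg (mul_nonneg (mul_nonneg (mul_nonneg hD0 hD0) hDmax) hXMX) hXMX) hK.le,
      mul_nonneg (mul_nonneg (mul_nonneg (mul_nonneg hD0 hD0) hDBg) hXMX) hTPXf,
      mul_nonneg (mul_nonneg (mul_nonneg (mul_nonneg hD0 hD0) hDBg) hTh1) hTPXf,
      mul_nonneg (mul_nonneg (mul_nonneg (mul_nonneg (mul_nonneg hD0 hD0) hDBg) hH) hTPXf) hK.le,
      mul_nonneg (mul_nonneg (mul_nonneg (mul_nonneg (mul_nonneg (mul_nonneg hD0 hD0) hDBg) hH) hXMX) hK.le) hK.le,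
      mul_nonneg (mul_nonneg (mul_nonneg (mul_nonneg hD0 hD0) hDBg) hDmax) hTPXf,
      mul_nonneg (mul_nonneg (mul_nonneg (mul_nonneg (mul_nonneg hD0 hD0) hDBg) hBD) hDmax) hK.le,
      mul_nonneg (mul_nonneg (mul_nonneg (mul_nonneg (mul_nonneg hD0 hD0) hDBg) hDBg) hXMX) hK.le,
      mul_nonneg (mul_nonneg (mul_nonneg (mul_nonneg (mul_nonneg hD0 hD0) hDBg) hDBg) hDmax) hK.le,
      mul_nonneg (mul_nonneg (mul_nonneg (mul_nonneg hD0 hD0) hD0) hBD) hTPXf,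
      mul_nonneg (mul_nonneg (mul_nonneg (mul_nonneg (mul_nonneg (mul_nonneg hD0 hD0) hD0) hBD) hH) hK.le) hK.le,
      mul_nonneg (mul_nonneg (mul_nonneg (mul_nonneg (mul_nonneg hD0 hD0) hD0) hDBg) hXMX) hK.le,
      mul_nonneg (mul_nonneg (mul_nonneg (mul_nonneg (mul_nonneg hD0 hD0) hD0) hD0) hBD) hK.le,
      mul_nonneg (mul_nonneg (mul_nonneg (mul_nonneg (mul_nonneg hChi hDmax) hH) hXMX) hTPXf) hK.le,
      mul_nonneg (mul_nonneg (mul_nonneg (mul_nonneg hChi hDmax) hDmax) hXMX) hTPXf,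
      mul_nonneg (mul_nonneg (mul_nonneg (mul_nonneg hChi hBD) hH) hYLX) hK.le,
      mul_nonneg (mul_nonneg (mul_nonneg (mul_nonneg (mul_nonneg hChi hBD) hH) hH) hYLX) hK.le,
      mul_nonneg (mul_nonneg (mul_nonneg hChi hBD) hDmax) hYLX,
      mul_nonneg (mul_nonneg (mul_nonneg (mul_nonneg hChi hDBg) hXMX) hXMX) hTPXf,
      mul_nonneg (mul_nonneg (mul_nonneg hChi hDBg) hTh1) hYLX,
      mul_nonneg (mul_nonneg (mul_nonneg (mul_nonneg (mul_nonneg hChi hDBg) hDmax) hDmax) hXMX) hK.le,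
      mul_nonneg (mul_nonneg (mul_nonneg (mul_nonneg (mul_nonneg hChi hDBg) hDBg) hH) hTPXf) hK.le,
      mul_nonneg (mul_nonneg (mul_nonneg (mul_nonneg hChi hDBg) hDBg) hH) hYLX,
      mul_nonneg (mul_nonneg (mul_nonneg (mul_nonneg hChi hDBg) hDBg) hDBg) hTPXf,
      mul_nonneg (mul_nonneg (mul_nonneg (mul_nonneg hChi hD0) hBD) hH) hYLX,
      mul_nonneg (mul_nonneg (mul_nonneg (mul_nonneg (mul_nonneg hChi hD0) hD0) hDBg) hDmax) hK.le,
      mul_nonneg (mul_nonneg (mul_nonneg (mul_nonneg (mul_nonneg hChi hChi) hBD) hBD) hDmax) hK.le,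
      mul_nonneg (mul_nonneg (mul_nonneg (mul_nonneg hChi hChi) hChi) hDBg) hTPXf,
      mul_nonneg (mul_nonneg (mul_nonneg (mul_nonneg hClo hDBg) hH) hTPXf) hTPXf,
      mul_nonneg (mul_nonneg (mul_nonneg (mul_nonneg hClo hDBg) hDmax) hH) hYLX,
      mul_nonneg (mul_nonneg (mul_nonneg (mul_nonneg (mul_nonneg hClo hDBg) hDmax) hDmax) hDmax) hK.le,
      mul_nonneg (mul_nonneg (mul_nonneg (mul_nonneg hClo hDBg) hDBg) hTh1) hTPXf,
      mul_nonneg (mul_nonneg (mul_nonneg (mul_nonneg (mul_nonneg hClo hDBg) hDBg) hDBg) hDBg) hK.le,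
      mul_nonneg (mul_nonneg (mul_nonneg (mul_nonneg (mul_nonneg hClo hD0) hDBg) hDBg) hDmax) hK.le,
      mul_nonneg (mul_nonneg (mul_nonneg (mul_nonneg hClo hD0) hD0) hDBg) hTPXf,
      mul_nonneg (mul_nonneg (mul_nonneg (mul_nonneg (mul_nonneg hClo hChi) hD0) hDBg) hDmax) hK.le,
      mul_nonneg (mul_nonneg (mul_nonneg (mul_nonneg (mul_nonneg hClo hChi) hD0) hD0) hXMX) hK.le,
      mul_nonneg (mul_nonneg (mul_nonneg (mul_nonneg hClo hClo) hDBg) hDBg) hTPXf,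
      mul_nonneg (mul_nonneg (mul_nonneg (mul_nonneg (mul_nonneg hClo hClo) hD0) hDmax) hXMX) hK.le,
      mul_nonneg (mul_nonneg (mul_nonneg (mul_nonneg hEg hH) hYLX) hTPXf) hK.le,
      mul_nonneg (mul_nonneg (mul_nonneg (mul_nonneg (mul_nonneg hEg hH) hXMX) hXMX) hYLX) hK.le,
      mul_nonneg (mul_nonneg (mul_nonneg (mul_nonneg hEg hDmax) hYLX) hK.le) hK.le,
      mul_nonneg (mul_nonneg (mul_nonneg (mul_nonneg (mul_nonneg (mul_nonneg hEg hDmax) hXMX) hXMX) hXMX) hK.le) hK.le,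
      mul_nonneg (mul_nonneg (mul_nonneg (mul_nonneg (mul_nonneg (mul_nonneg (mul_nonneg hEg hDmax) hDmax) hDmax) hGam) hK.le) hK.le) hK.le,
      mul_nonneg (mul_nonneg (mul_nonneg (mul_nonneg hEg hDBg) hDmax) hYLX) hK.le,
      mul_nonneg (mul_nonneg (mul_nonneg (mul_nonneg (mul_nonneg (mul_nonneg hEg hDBg) hDmax) hDmax) hXMX) hK.le) hK.le,
      mul_nonneg (mul_nonneg (mul_nonneg hEg hD0) hYLX) hTPXf,
      mul_nonneg (mul_nonneg (mul_nonneg (mul_nonneg (mul_nonneg (mul_nonneg hEg hD0) hXMX) hK.le) hK.le) hK.le) hK.le,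
      mul_nonneg (mul_nonneg (mul_nonneg (mul_nonneg (mul_nonneg hEg hD0) hXMX) hTPXf) hK.le) hK.le,
      mul_nonneg (mul_nonneg (mul_nonneg (mul_nonneg (mul_nonneg (mul_nonneg hEg hD0) hTh1) hTh1) hTh1) hK.le) hK.le,
      mul_nonneg (mul_nonneg (mul_nonneg (mul_nonneg (mul_nonneg (mul_nonneg hEg hD0) hGam) hTh1) hTPXf) hK.le) hK.le,
      mul_nonneg (mul_nonneg (mul_nonneg (mul_nonneg (mul_nonneg hEg hD0) hD0) hTh1) hTPXf) hK.le,
      mul_nonneg (mul_nonneg (mul_nonneg (mul_nonneg (mul_nonneg (mul_nonneg hEg hD0) hD0) hBD) hXMX) hK.le) hK.le,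
      mul_nonneg (mul_nonneg (mul_nonneg (mul_nonneg (mul_nonneg (mul_nonneg hEg hD0) hD0) hDBg) hDmax) hK.le) hK.le,
      mul_nonneg (mul_nonneg (mul_nonneg (mul_nonneg hEg hChi) hDmax) hYLX) hK.le,
      mul_nonneg (mul_nonneg (mul_nonneg (mul_nonneg hEg hChi) hChi) hDmax) hYLX,
      mul_nonneg (mul_nonneg (mul_nonneg (mul_nonneg (mul_nonneg hEg hClo) hDmax) hTh1) hTPXf) hK.le,
      mul_nonneg (mul_nonneg (mul_nonneg (mul_nonneg hEg hClo) hD0) hTPXf) hTPXf,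
      mul_nonneg (mul_nonneg (mul_nonneg (mul_nonneg (mul_nonneg (mul_nonneg hEg hClo) hD0) hGam) hTPXf) hK.le) hK.le,
      mul_nonneg (mul_nonneg (mul_nonneg (mul_nonneg (mul_nonneg hEg hClo) hD0) hD0) hTPXf) hK.le,
      mul_nonneg (mul_nonneg (mul_nonneg (mul_nonneg hEg hClo) hClo) hTPXf) hTPXf,
      mul_nonneg (mul_nonneg (mul_nonneg (mul_nonneg (mul_nonneg (mul_nonneg (mul_nonneg hEg hEg) hGam) hXMX) hTPXf) hK.le) hK.le) hK.le,
      mul_nonneg (mul_nonneg (mul_nonneg (mul_nonneg (mul_nonneg hEg hEg) hBD) hXMX) hYLX) hK.le,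
      mul_nonneg (mul_nonneg (mul_nonneg (mul_nonneg (mul_nonneg hEg hEg) hD0) hTh1) hYLX) hK.le,
      mul_nonneg (mul_nonneg (mul_nonneg (mul_nonneg (mul_nonneg hEg hEg) hD0) hDmax) hYLX) hK.le,
      mul_nonneg (mul_nonneg (mul_nonneg (mul_nonneg (mul_nonneg hEg hEg) hClo) hTPXf) hTPXf) hK.le,
      mul_nonneg (mul_nonneg (mul_nonneg hBig hBD) hDmax) hYLX,
      mul_nonneg (mul_nonneg (mul_nonneg (mul_nonneg (mul_nonneg hBig hDBg) hDBg) hDBg) hBD) hK.le,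
      mul_nonneg (mul_nonneg (mul_nonneg (mul_nonneg hBig hD0) hD0) hBD) hTPXf,
      mul_nonneg (mul_nonneg (mul_nonneg (mul_nonneg (mul_nonneg hBig hD0) hD0) hDBg) hDBg) hK.le,
      mul_nonneg (mul_nonneg (mul_nonneg (mul_nonneg hBig hChi) hBD) hH) hYLX,
      mul_nonneg (mul_nonneg (mul_nonneg (mul_nonneg (mul_nonneg hBig hChi) hChi) hDmax) hXMX) hK.le,
      mul_nonneg (mul_nonneg (mul_nonneg (mul_nonneg (mul_nonneg hBig hClo) hD0) hD0) hXMX) hK.le,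
      mul_nonneg (mul_nonneg (mul_nonneg (mul_nonneg (mul_nonneg hBig hEg) hTh1) hXMX) hTPXf) hK.le,
      mul_nonneg (mul_nonneg (mul_nonneg (mul_nonneg (mul_nonneg (mul_nonneg hBig hEg) hBD) hBD) hDmax) hK.le) hK.le,
      mul_nonneg (mul_nonneg (mul_nonneg (mul_nonneg (mul_nonneg (mul_nonneg hBig hEg) hDBg) hK.le) hK.le) hK.le) hK.le,
      mul_nonneg (mul_nonneg (mul_nonneg (mul_nonneg (mul_nonneg (mul_nonneg hBig hEg) hDBg) hDmax) hXMX) hK.le) hK.le,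
      mul_nonneg (mul_nonneg (mul_nonneg (mul_nonneg (mul_nonneg (mul_nonneg hBig hEg) hDBg) hDmax) hDmax) hK.le) hK.le,
      mul_nonneg (mul_nonneg (mul_nonneg (mul_nonneg (mul_nonneg (mul_nonneg hBig hEg) hDBg) hDBg) hBD) hK.le) hK.le,
      mul_nonneg (mul_nonneg (mul_nonneg (mul_nonneg hBig hEg) hChi) hTPXf) hTPXf,
      mul_nonneg (mul_nonneg (mul_nonneg hBig hBig) hBD) hYLX,
      mul_nonneg (mul_nonneg (mul_nonneg (mul_nonneg (mul_nonneg hBig hBig) hBD) hDmax) hTh1) hK.le,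
      mul_nonneg (mul_nonneg (mul_nonneg (mul_nonneg (mul_nonneg hBig hBig) hDBg) hDmax) hXMX) hK.le,
      mul_nonneg (mul_nonneg (mul_nonneg (mul_nonneg hBig hBig) hChi) hXMX) hTPXf,
      mul_nonneg (mul_nonneg (mul_nonneg (mul_nonneg (mul_nonneg hBig hBig) hEg) hH) hYLX) hK.le,
      mul_nonneg (mul_nonneg (mul_nonneg (mul_nonneg (mul_nonneg (mul_nonneg hBig hBig) hEg) hDmax) hXMX) hK.le) hK.le,
      mul_nonneg (mul_nonneg (mul_nonneg (mul_nonneg (mul_nonneg (mul_nonneg hBig hBig) hEg) hBD) hK.le) hK.le) hK.le,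
      mul_nonneg (mul_nonneg (mul_nonneg (mul_nonneg (mul_nonneg (mul_nonneg hBig hBig) hEg) hDBg) hDmax) hK.le) hK.le,
      mul_nonneg (mul_nonneg (mul_nonneg (mul_nonneg (mul_nonneg (mul_nonneg hBig hBig) hEg) hDBg) hBD) hK.le) hK.le,
      mul_nonneg (mul_nonneg (mul_nonneg (mul_nonneg (mul_nonneg hBig hBig) hBig) hDBg) hDmax) hK.le,
      mul_nonneg (mul_nonneg (mul_nonneg (mul_nonneg (mul_nonneg hBig hBig) hBig) hClo) hBD) hK.le,
      mul_nonneg (mul_nonneg (mul_nonneg (mul_nonneg (mul_nonneg (mul_nonneg hBig hBig) hBig) hEg) hDmax) hK.le) hK.le,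
      mul_nonneg (mul_nonneg (mul_nonneg hE hYLX) hTPXf) hK.le,
      mul_nonneg (mul_nonneg (mul_nonneg (mul_nonneg hE hXMX) hYLX) hK.le) hK.le,
      mul_nonneg (mul_nonneg (mul_nonneg (mul_nonneg (mul_nonneg (mul_nonneg hE hXMX) hXMX) hXMX) hXMX) hK.le) hK.le,
      mul_nonneg (mul_nonneg (mul_nonneg (mul_nonneg hE hH) hYLX) hTPXf) hK.le,
      mul_nonneg (mul_nonneg (mul_nonneg (mul_nonneg hE hDmax) hYLX) hK.le) hK.le,
      mul_nonneg (mul_nonneg (mul_nonneg (mul_nonneg (mul_nonneg (mul_nonneg hE hDmax) hDmax) hXMX) hK.le) hK.le) hK.le,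
      mul_nonneg (mul_nonneg (mul_nonneg (mul_nonneg (mul_nonneg (mul_nonneg hE hDmax) hDmax) hDmax) hTh1) hK.le) hK.le,
      mul_nonneg (mul_nonneg (mul_nonneg (mul_nonneg hE hBD) hTPXf) hTPXf) hK.le,
      mul_nonneg (mul_nonneg (mul_nonneg (mul_nonneg hE hBD) hYLX) hK.le) hK.le,
      mul_nonneg (mul_nonneg (mul_nonneg (mul_nonneg (mul_nonneg hE hBD) hH) hYLX) hK.le) hK.le,
      mul_nonneg (mul_nonneg (mul_nonneg (mul_nonneg (mul_nonneg (mul_nonneg hE hBD) hH) hH) hYLX) hK.le) hK.le,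
      mul_nonneg (mul_nonneg (mul_nonneg (mul_nonneg hE hDBg) hTh1) hYLX) hK.le,
      mul_nonneg (mul_nonneg (mul_nonneg (mul_nonneg (mul_nonneg (mul_nonneg hE hD0) hXMX) hK.le) hK.le) hK.le) hK.le,
      mul_nonneg (mul_nonneg (mul_nonneg (mul_nonneg (mul_nonneg (mul_nonneg hE hD0) hGam) hXMX) hTPXf) hK.le) hK.le,
      mul_nonneg (mul_nonneg (mul_nonneg (mul_nonneg (mul_nonneg (mul_nonneg hE hD0) hDmax) hDmax) hDmax) hK.le) hK.le,
      mul_nonneg (mul_nonneg (mul_nonneg (mul_nonneg (mul_nonneg hE hD0) hBD) hH) hYLX) hK.le,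
      mul_nonneg (mul_nonneg (mul_nonneg (mul_nonneg (mul_nonneg hE hD0) hBD) hBD) hTPXf) hK.le,
      mul_nonneg (mul_nonneg (mul_nonneg (mul_nonneg (mul_nonneg (mul_nonneg hE hD0) hDBg) hTh1) hTh1) hK.le) hK.le,
      mul_nonneg (mul_nonneg (mul_nonneg (mul_nonneg (mul_nonneg (mul_nonneg hE hD0) hD0) hXMX) hK.le) hK.le) hK.le,
      mul_nonneg (mul_nonneg (mul_nonneg (mul_nonneg (mul_nonneg hE hD0) hD0) hXMX) hTPXf) hK.le,
      mul_nonneg (mul_nonneg (mul_nonneg (mul_nonneg (mul_nonneg (mul_nonneg hE hD0) hD0) hDBg) hTh1) hK.le) hK.le,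
      mul_nonneg (mul_nonneg (mul_nonneg (mul_nonneg (mul_nonneg hE hD0) hD0) hD0) hTPXf) hK.le,
      mul_nonneg (mul_nonneg (mul_nonneg (mul_nonneg hE hChi) hDmax) hYLX) hK.le,
      mul_nonneg (mul_nonneg (mul_nonneg (mul_nonneg (mul_nonneg hE hChi) hD0) hH) hYLX) hK.le,
      mul_nonneg (mul_nonneg (mul_nonneg (mul_nonneg hE hClo) hTPXf) hTPXf) hK.le,
      mul_nonneg (mul_nonneg (mul_nonneg (mul_nonneg (mul_nonneg (mul_nonneg (mul_nonneg hE hClo) hH) hK.le) hK.le) hK.le) hK.le) hK.le,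
      mul_nonneg (mul_nonneg (mul_nonneg (mul_nonneg (mul_nonneg (mul_nonneg hE hClo) hDmax) hDmax) hDmax) hK.le) hK.le,
      mul_nonneg (mul_nonneg (mul_nonneg (mul_nonneg hE hClo) hDBg) hYLX) hK.le,
      mul_nonneg (mul_nonneg (mul_nonneg (mul_nonneg (mul_nonneg (mul_nonneg hE hClo) hD0) hH) hTPXf) hK.le) hK.le,
      mul_nonneg (mul_nonneg (mul_nonneg (mul_nonneg (mul_nonneg hE hClo) hD0) hD0) hTPXf) hK.le,
      mul_nonneg (mul_nonneg (mul_nonneg (mul_nonneg (mul_nonneg (mul_nonneg (mul_nonneg hE hEg) hH) hXMX) hTPXf) hK.le) hK.le) hK.le,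
      mul_nonneg (mul_nonneg (mul_nonneg (mul_nonneg (mul_nonneg (mul_nonneg hE hEg) hDmax) hTh1) hTPXf) hK.le) hK.le,
      mul_nonneg (mul_nonneg (mul_nonneg (mul_nonneg (mul_nonneg (mul_nonneg (mul_nonneg hE hEg) hBD) hBD) hBD) hK.le) hK.le) hK.le,
      mul_nonneg (mul_nonneg (mul_nonneg (mul_nonneg (mul_nonneg hE hEg) hD0) hDmax) hYLX) hK.le,
      mul_nonneg (mul_nonneg (mul_nonneg (mul_nonneg (mul_nonneg (mul_nonneg (mul_nonneg hE hEg) hD0) hD0) hXMX) hK.le) hK.le) hK.le,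
      mul_nonneg (mul_nonneg (mul_nonneg (mul_nonneg (mul_nonneg (mul_nonneg (mul_nonneg hE hEg) hChi) hDBg) hDBg) hK.le) hK.le) hK.le,
      mul_nonneg (mul_nonneg (mul_nonneg (mul_nonneg (mul_nonneg hE hEg) hClo) hYLX) hK.le) hK.le,
      mul_nonneg (mul_nonneg (mul_nonneg (mul_nonneg (mul_nonneg (mul_nonneg (mul_nonneg hE hEg) hEg) hBD) hTPXf) hK.le) hK.le) hK.le,
      mul_nonneg (mul_nonneg (mul_nonneg (mul_nonneg (mul_nonneg (mul_nonneg (mul_nonneg (mul_nonneg hE hEg) hEg) hBD) hTh1) hK.le) hK.le) hK.le) hK.le,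
      mul_nonneg (mul_nonneg (mul_nonneg (mul_nonneg (mul_nonneg (mul_nonneg (mul_nonneg (mul_nonneg hE hEg) hEg) hChi) hDBg) hK.le) hK.le) hK.le) hK.le,
      mul_nonneg (mul_nonneg (mul_nonneg (mul_nonneg (mul_nonneg (mul_nonneg (mul_nonneg (mul_nonneg hE hEg) hEg) hChi) hD0) hK.le) hK.le) hK.le) hK.le,
      mul_nonneg (mul_nonneg (mul_nonneg (mul_nonneg (mul_nonneg (mul_nonneg hE hBig) hBD) hBD) hXMX) hK.le) hK.le,
      mul_nonneg (mul_nonneg (mul_nonneg (mul_nonneg (mul_nonneg (mul_nonneg hE hBig) hDBg) hDmax) hDmax) hK.le) hK.le,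
      mul_nonneg (mul_nonneg (mul_nonneg (mul_nonneg (mul_nonneg (mul_nonneg hE hBig) hClo) hDBg) hXMX) hK.le) hK.le,
      mul_nonneg (mul_nonneg (mul_nonneg (mul_nonneg (mul_nonneg (mul_nonneg (mul_nonneg (mul_nonneg hE hBig) hEg) hEg) hK.le) hK.le) hK.le) hK.le) hK.le,
      mul_nonneg (mul_nonneg (mul_nonneg (mul_nonneg (mul_nonneg (mul_nonneg hE hBig) hBig) hDBg) hDmax) hK.le) hK.le,
      mul_nonneg (mul_nonneg (mul_nonneg (mul_nonneg (mul_nonneg (mul_nonneg hE hBig) hBig) hClo) hDBg) hK.le) hK.le,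
      mul_nonneg (mul_nonneg (mul_nonneg (mul_nonneg (mul_nonneg (mul_nonneg (mul_nonneg hE hBig) hBig) hEg) hDmax) hK.le) hK.le) hK.le,
      mul_nonneg (mul_nonneg (mul_nonneg (mul_nonneg (mul_nonneg (mul_nonneg hE hE) hTPXf) hK.le) hK.le) hK.le) hK.le,
      mul_nonneg (mul_nonneg (mul_nonneg (mul_nonneg (mul_nonneg hE hE) hTPXf) hTPXf) hK.le) hK.le,
      mul_nonneg (mul_nonneg (mul_nonneg (mul_nonneg (mul_nonneg hE hE) hXMX) hYLX) hK.le) hK.le,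
      mul_nonneg (mul_nonneg (mul_nonneg (mul_nonneg (mul_nonneg hE hE) hDmax) hYLX) hK.le) hK.le,
      mul_nonneg (mul_nonneg (mul_nonneg (mul_nonneg (mul_nonneg (mul_nonneg (mul_nonneg hE hE) hDmax) hXMX) hXMX) hK.le) hK.le) hK.le,
      mul_nonneg (mul_nonneg (mul_nonneg (mul_nonneg (mul_nonneg (mul_nonneg hE hE) hDmax) hH) hYLX) hK.le) hK.le,
      mul_nonneg (mul_nonneg (mul_nonneg (mul_nonneg (mul_nonneg (mul_nonneg hE hE) hD0) hTPXf) hK.le) hK.le) hK.le,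
      mul_nonneg (mul_nonneg (mul_nonneg (mul_nonneg (mul_nonneg (mul_nonneg (mul_nonneg hE hE) hD0) hD0) hD0) hK.le) hK.le) hK.le,
      mul_nonneg (mul_nonneg (mul_nonneg (mul_nonneg (mul_nonneg (mul_nonneg (mul_nonneg hE hE) hClo) hD0) hD0) hK.le) hK.le) hK.le,
      mul_nonneg (mul_nonneg (mul_nonneg (mul_nonneg (mul_nonneg (mul_nonneg hE hE) hEg) hXMX) hYLX) hK.le) hK.le,
      mul_nonneg (mul_nonneg (mul_nonneg (mul_nonneg (mul_nonneg (mul_nonneg (mul_nonneg (mul_nonneg hE hE) hEg) hBD) hXMX) hK.le) hK.le) hK.le) hK.le,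
      mul_nonneg (mul_nonneg (mul_nonneg (mul_nonneg (mul_nonneg (mul_nonneg (mul_nonneg hE hE) hBig) hBig) hBD) hK.le) hK.le) hK.le,
      mul_nonneg (mul_nonneg (mul_nonneg (mul_nonneg (mul_nonneg (mul_nonneg (mul_nonneg hE hE) hBig) hBig) hClo) hK.le) hK.le) hK.le,
      mul_nonneg (mul_nonneg (mul_nonneg (mul_nonneg (mul_nonneg (mul_nonneg (mul_nonneg (mul_nonneg hE hE) hE) hDmax) hDmax) hK.le) hK.le) hK.le) hK.le,
      mul_nonneg (mul_nonneg (mul_nonneg (mul_nonneg (mul_nonneg (mul_nonneg (mul_nonneg (mul_nonneg hE hE) hE) hD0) hBD) hK.le) hK.le) hK.le) hK.le,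
      mul_nonneg (mul_nonneg (mul_nonneg (mul_nonneg (mul_nonneg (mul_nonneg (mul_nonneg (mul_nonneg (mul_nonneg (mul_nonneg hE hE) hE) hE) hE) hK.le) hK.le) hK.le) hK.le) hK.le) hK.le,
      mul_nonneg (mul_nonneg (mul_nonneg hA hXMX) hXMX) hYLX,
      mul_nonneg (mul_nonneg (mul_nonneg (mul_nonneg (mul_nonneg hA hBD) hGam) hTh1) hTPXf) hK.le,
      mul_nonneg (mul_nonneg (mul_nonneg (mul_nonneg (mul_nonneg hA hBD) hH) hTh1) hTPXf) hK.le,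
      mul_nonneg (mul_nonneg (mul_nonneg (mul_nonneg hA hBD) hDmax) hXMX) hTPXf,
      mul_nonneg (mul_nonneg (mul_nonneg (mul_nonneg (mul_nonneg hA hDBg) hDBg) hH) hTPXf) hK.le,
      mul_nonneg (mul_nonneg (mul_nonneg (mul_nonneg (mul_nonneg hA hDBg) hDBg) hDBg) hBD) hK.le,
      mul_nonneg (mul_nonneg (mul_nonneg (mul_nonneg hA hD0) hH) hXMX) hYLX,
      mul_nonneg (mul_nonneg (mul_nonneg (mul_nonneg (mul_nonneg hA hD0) hD0) hTh1) hXMX) hK.le,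
      mul_nonneg (mul_nonneg (mul_nonneg (mul_nonneg (mul_nonneg hA hD0) hD0) hBD) hDmax) hK.le,
      mul_nonneg (mul_nonneg (mul_nonneg (mul_nonneg hA hChi) hDmax) hXMX) hTPXf,
      mul_nonneg (mul_nonneg (mul_nonneg (mul_nonneg hA hClo) hD0) hDBg) hTPXf,
      mul_nonneg (mul_nonneg (mul_nonneg (mul_nonneg (mul_nonneg hA hClo) hD0) hD0) hXMX) hK.le,
      mul_nonneg (mul_nonneg (mul_nonneg (mul_nonneg (mul_nonneg hA hEg) hTh1) hTh1) hTPXf) hK.le,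
      mul_nonneg (mul_nonneg (mul_nonneg (mul_nonneg hA hEg) hChi) hDmax) hYLX,
      mul_nonneg (mul_nonneg (mul_nonneg (mul_nonneg (mul_nonneg hA hEg) hClo) hD0) hTPXf) hK.le,
      mul_nonneg (mul_nonneg (mul_nonneg (mul_nonneg hA hBig) hChi) hXMX) hTPXf,
      mul_nonneg (mul_nonneg (mul_nonneg (mul_nonneg (mul_nonneg hA hBig) hEg) hBD) hTPXf) hK.le,
      mul_nonneg (mul_nonneg (mul_nonneg (mul_nonneg (mul_nonneg hA hA) hClo) hD0) hDBg) hK.le,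
      mul_nonneg (mul_nonneg (mul_nonneg (mul_nonneg (mul_nonneg hA hA) hClo) hClo) hDBg) hK.le,
      mul_nonneg (mul_nonneg (mul_nonneg (mul_nonneg (mul_nonneg hA hA) hEg) hBD) hTPXf) hK.le,
      mul_nonneg (mul_nonneg (mul_nonneg (mul_nonneg (mul_nonneg hA hA) hA) hBD) hK.le) hK.le,
      mul_nonneg (mul_nonneg (mul_nonneg (mul_nonneg (mul_nonneg hA hA) hA) hBD) hBD) hK.le,
      mul_nonneg (mul_nonneg (mul_nonneg (mul_nonneg (mul_nonneg hA hA) hA) hD0) hBD) hK.le,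
      mul_nonneg (mul_nonneg (mul_nonneg (mul_nonneg hA hA) hA) hEg) hYLX,
      mul_nonneg (mul_nonneg (mul_nonneg (mul_nonneg (mul_nonneg (mul_nonneg hA hA) hA) hEg) hClo) hK.le) hK.le,
      mul_nonneg (mul_nonneg (mul_nonneg (mul_nonneg (mul_nonneg (mul_nonneg (mul_nonneg hA hA) hA) hE) hE) hK.le) hK.le) hK.le]
  by_contra hc; push Not at hc
  have := mul_neg_of_pos_of_neg (pow_pos hK 2) (show (((1 - γ) * (1 - g)) * (lo + D) + (γ * (1 - g)) * (lo + D - K) + ((1 - γ) * g) * (D - K)) * D * ((lo + K) * (lo + K * γ + (lo + K) * g) - (2 * lo + D) * (lo + K * γ)) - ((2 * K - D) * ((2 * lo + D) * (lo + K * γ)) * (1 - γ) * (D - (lo + K) * g)) < 0 by linarith)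
  linarith

end LawDec
end Quant
end Summit.CriticalPhenomena.PercolationContinuityZ3.Theorems
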